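import Literature.Computability.MetaComplexity.DistProblemsProofs
import Literature.Computability.Complexity.ClockedUniversalAcceptanceProofs
import Literature.Computability.Complexity.StringCopy
import Literature.Computability.Complexity.CookReducibilityTransitive
import Literature.Computability.Complexity.PRelHierarchy
import Mathlib.Analysis.SpecialFunctions.Pow.Real
import HarnessLib

/-!
# Levin's average polynomial time yields errorless heuristic schemes: `AvgPLevin ⊆ AvgP`

Topic `Literature/Computability/MetaComplexity`, first half of the discharge of the named fact
`Literature.Computability.MetaComplexity.mem_AvgP_iff_mem_AvgPLevin` (`DistProblems.lean`;
Bogdanov–Trevisan 2006, §2.2.1, Prop. 7 of arXiv cs/0606037v2 — "a distributional problem admits a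
fully polynomial-time errorless heuristic scheme if and only if it admits an algorithm whose running
time is average-polynomial", with Prop. 5, the Markov step from Levin's Def. 4 to the trade-off
Def. 3; Impagliazzo 1995, Prop. 2). This file proves the direction

* `mem_AvgP_of_mem_AvgPLevin : Q ∈ AvgPLevin → Q ∈ AvgP`

(for EVERY ensemble — the hypothesis `HasPolyLength` of the named fact is only needed for the
converse), following the printed proof: "define the algorithm `A'` that on input `x` and parameters
`n, δ` simulates `A(x; n)` for `(p(n)/δ)^{1/ε}` steps; if the simulation halts within the required
number of steps, `A'` gives the same output as `A`, otherwise it outputs `⊥`" (Bogdanov–Trevisan,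
proof of Prop. 7), the failure probability being bounded by Markov's inequality
`Pr[t_A(x; n) ≥ t] = Pr[t_A^ε ≥ t^ε] ≤ 𝔼[t_A^ε]/t^ε` (proof of Prop. 5).

## The simulation in the tree's machine model

The clock is the tree's **clocked universal acceptance test** (`clockedUniversalAcceptance_holds`,
`ClockedUniversalAcceptanceProofs.lean`; Arora–Barak 2009, Thm. 1.9 and §1.4.1): a language `U ∈ P`
of instances `⟨e, ⟨w, 1ᴺ⟩⟩` with, for every machine, a code `e` and an overhead polynomial `p` such
that `⟨e, ⟨w, 1ᴺ⟩⟩ ∈ U` whenever the machine outputs `[true]` on `w` within `t` steps and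
`p(t) ≤ N` (completeness), and `⟨e, ⟨w, 1ᴺ⟩⟩ ∈ U` only if the machine outputs `[true]` on `w` at
all (soundness). Given the average-polynomial machine `M` of `(L, D)` (`𝔼_{x∼Dₙ}[T(x,n)^ε] ≤ cn + c`,
output `[L(x)]` on `⟨x, 1ⁿ⟩` within `T(x, n)` steps on the support) we query `U` twice: for `M`
(code `e₁`) and for `M` followed by the negation transducer (code `e₂`; it outputs `[true]` exactly
when `M` outputs `[false]`), with the common budget `N(n, m) = P(2n + 2 + m)`, `P` a polynomial
dominating both overheads at the Markov threshold `t(n, m) = ((c+1)(n+1)m)^k`, `k = ⌈1/ε⌉`: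

  `A(x; 1ⁿ, 1ᵐ) = 1` if `⟨e₁, ⟨⟨x,1ⁿ⟩, 1ᴺ⟩⟩ ∈ U`, else `0` if `⟨e₂, ⟨⟨x,1ⁿ⟩, 1ᴺ⟩⟩ ∈ U`, else `⊥`.

* polynomial time in `|⟨x, 1ⁿ, 1ᵐ⟩|`: `A` is a term of the tree's `FP` algebra (`pairFn`, `padFn`,
  `iteFn`, the indicator of `U ∈ P`) evaluated on the scheme encoding (`scheme_realiser`);
* errorless on the support: by soundness of `U` and uniqueness of machine outputs
  (`TM2Std.outputs_unique`), an accepted query certifies the answer of `M`, which is `L(x)`;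
* failure probability: if `x ∈ supp Dₙ` fails then `T(x, n) > t(n, m)` (completeness of `U` and
  monotonicity of `ℕ`-polynomials), and `Pr_{x∼Dₙ}[T(x,n) > t] ≤ (cn + c)/t^ε ≤ 1/m` since
  `t^ε = ((c+1)(n+1)m)^{kε} ≥ (c+1)(n+1)m` (`Ensemble.prob_lt_le_of_moment_le`, Markov's inequality
  on the `ℝ≥0∞`-valued expectation of `Ensemble.IsPolyOnAverage`).

## References

* A. Bogdanov, L. Trevisan, *Average-Case Complexity*, Found. Trends TCS 2 (2006) 1–106,
  §2.2.1: arXiv cs/0606037v2 Def. 3, Def. 4, Prop. 5 (proof: Markov), Def. 6, Prop. 7 (proof, first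
  paragraph), Def. 8. doi:10.1561/0400000004
* R. Impagliazzo, *A personal view of average-case complexity*, Structure in Complexity Theory
  1995, §2, Prop. 2 (p. 11: "`B(x; δ)` simulates `A` for `O(n/δ)^{1/ε}` steps, and outputs `?` if
  `A` fails to halt"). doi:10.1109/sct.1995.514853
* S. Arora, B. Barak, *Computational Complexity: A Modern Approach*, CUP 2009, Thm. 1.9 and
  §1.4.1 (universal TM with time bound), §18.1 (remark after Def. 18.4: Markov).
-/

namespace Literature.Computability.MetaComplexity

open _root_.Computability Complexity Complexity.Classes Turing Polynomial
open scoped ENNReal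

/-! ### Markov's inequality for the `ℝ≥0∞`-valued moment of `IsPolyOnAverage` -/

/-- **Markov's inequality for running times** (Bogdanov–Trevisan 2006, proof of Prop. 5:
`Pr[t_A(x;n) ≥ t] = Pr[t_A^ε ≥ t^ε] ≤ 𝔼[t_A^ε]/t^ε`), in the tree's `ℝ≥0∞` form: if
`Σₓ Dₙ(x)·T(x,n)^ε ≤ B` and `0 < K ≤ t^ε`, then `Pr_{x∼Dₙ}[t < T(x, n)] ≤ B / K`. A deliberate
dot-notation extension of `Ensemble`. [cite: BogdanovTrevisan2006, §2.2.1, Prop. 5 (proof; arXiv cs/0606037v2)] -/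
theorem Ensemble.prob_lt_le_of_moment_le (D : Ensemble) {T : List Bool → ℕ → ℕ} {ε : ℝ}
    (hε : 0 < ε) {n t : ℕ} {B K : ℝ} (hB0 : 0 ≤ B)
    (hB : ∑' x, D n x * ENNReal.ofReal ((T x n : ℝ) ^ ε) ≤ ENNReal.ofReal B) (hK : 0 < K)
    (ht : K ≤ (t : ℝ) ^ ε) : D.prob n {x | t < T x n} ≤ B / K := by
  unfold Ensemble.prob
  rw [PMF.toOuterMeasure_apply]
  refine ENNReal.toReal_le_of_le_ofReal (div_nonneg hB0 hK.le) ?_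
  have hK0 : ENNReal.ofReal K ≠ 0 := (ENNReal.ofReal_pos.2 hK).ne'
  have key : ∀ x, Set.indicator {x | t < T x n} (D n) x ≤
      D n x * ENNReal.ofReal ((T x n : ℝ) ^ ε) * (ENNReal.ofReal K)⁻¹ := by
    intro x
    by_cases hx : x ∈ {x | t < T x n}
    · rw [Set.indicator_of_mem hx, mul_assoc]
      refine le_mul_of_one_le_right bot_le ?_
      have hx' : t < T x n := hx
      have h1 : ENNReal.ofReal K ≤ ENNReal.ofReal ((T x n : ℝ) ^ ε) := by
        refine ENNReal.ofReal_le_ofReal (ht.trans ?_)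
        exact Real.rpow_le_rpow (Nat.cast_nonneg _) (by exact_mod_cast hx'.le) hε.le
      calc (1 : ℝ≥0∞) = ENNReal.ofReal K * (ENNReal.ofReal K)⁻¹ :=
            (ENNReal.mul_inv_cancel hK0 ENNReal.ofReal_ne_top).symm
        _ ≤ ENNReal.ofReal ((T x n : ℝ) ^ ε) * (ENNReal.ofReal K)⁻¹ := by gcongr
    · rw [Set.indicator_of_notMem hx]
      exact bot_le
  calc ∑' x, Set.indicator {x | t < T x n} (D n) x
      ≤ ∑' x, D n x * ENNReal.ofReal ((T x n : ℝ) ^ ε) * (ENNReal.ofReal K)⁻¹ :=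
        ENNReal.tsum_le_tsum key
    _ = (∑' x, D n x * ENNReal.ofReal ((T x n : ℝ) ^ ε)) * (ENNReal.ofReal K)⁻¹ :=
        ENNReal.tsum_mul_right
    _ ≤ ENNReal.ofReal B * (ENNReal.ofReal K)⁻¹ := by gcongr
    _ = ENNReal.ofReal (B / K) := by
        rw [div_eq_mul_inv, ENNReal.ofReal_mul hB0, ENNReal.ofReal_inv_of_pos hK]

/-- The Markov threshold: with `k = ⌈1/ε⌉`, `b ≤ (b^k)^ε` for every natural `b ≥ 1` (because
`kε ≥ 1`). This is the choice of the simulation budget "`(p(n)/δ)^{1/ε}` steps" of the printed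
proof, rounded to a natural exponent. [cite: BogdanovTrevisan2006, §2.2.1, Prop. 7 (proof; arXiv cs/0606037v2)] -/
theorem natCast_le_pow_ceil_rpow {ε : ℝ} (hε : 0 < ε) {b : ℕ} (hb : 1 ≤ b) :
    (b : ℝ) ≤ ((b ^ ⌈1 / ε⌉₊ : ℕ) : ℝ) ^ ε := by
  have hk : (1 : ℝ) ≤ (⌈1 / ε⌉₊ : ℝ) * ε := by
    have h1 : 1 / ε ≤ (⌈1 / ε⌉₊ : ℝ) := Nat.le_ceil _
    calc (1 : ℝ) = 1 / ε * ε := by field_simp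
      _ ≤ (⌈1 / ε⌉₊ : ℝ) * ε := by gcongr
  have hb' : (1 : ℝ) ≤ b := by exact_mod_cast hb
  rw [Nat.cast_pow, ← Real.rpow_natCast, ← Real.rpow_mul (Nat.cast_nonneg _)]
  calc (b : ℝ) = (b : ℝ) ^ (1 : ℝ) := (Real.rpow_one _).symm
    _ ≤ (b : ℝ) ^ ((⌈1 / ε⌉₊ : ℝ) * ε) := Real.rpow_le_rpow_of_exponent_le hb' hk

/-! ### Machine lemmas -/

/-- **Negating the answer.** For every machine `M` there is a machine `M'` and a constant `c₁`
such that whenever `M` outputs the bit `b` on `w` within `t` steps, `M'` outputs `¬b` on `w`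
within `c₁ + t` steps: `M` followed (`Turing.TM2ComputableAux.comp`, additive time) by the
one-state transducer `b ↦ ¬b` (linear time, `FST.timeComputable_eval`).
[cite: AroraBarak2009, §1.3 (composition of machines)] -/
theorem exists_neg_machine (M : TM2ComputableAux Bool Bool) :
    ∃ (M' : TM2ComputableAux Bool Bool) (c₁ : ℕ),
      ∀ (w : List Bool) (b : Bool) (t : ℕ), M.OutputsWithin w [b] t → M'.OutputsWithin w [!b] (c₁ + t) := by
  let negT : FST Unit Bool Bool := ⟨(), fun _ b => ((), [!b]), fun _ => [], fun _ => true⟩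
  obtain ⟨N, hN⟩ := negT.timeComputable_eval
  refine ⟨M.comp N, (negT.maxEmit + 1) * 1 + 3, fun w b t h => ?_⟩
  have h2 : N.OutputsWithin [b] [!b] ((negT.maxEmit + 1) * 1 + 3) := hN [b]
  exact TM2ComputableAux.comp_outputsWithin M N h h2

/-- `|1ⁿ| = n` (Mathlib's `unaryDecodeNat` is `List.length`). [folklore] -/
private theorem length_unaryEncodeNat_eq' (n : ℕ) : (unaryEncodeNat n).length = n :=
  unary_decode_encode_nat n

/-! ### The errorless heuristic scheme as an `FP` term on the scheme encoding

A string function `g ∈ FP` that agrees with `optBoolEnc ∘ f` on the scheme encoding realises `f`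
as a polynomial-time algorithm `A(x; 1ⁿ, 1ᵐ) ∈ {0, 1, ⊥}`: this is the re-indexing lemma
`PolyTimeComputable.of_encode` (`StackMachines.lean`) along `schemeEnc`. -/

/-- **The scheme is polynomial-time.** For `U ∈ P`, codes `e₁, e₂` and a budget polynomial `P`,
the `{0, 1, ⊥}`-valued algorithm `A(x; 1ⁿ, 1ᵐ)` answering `1` if `⟨e₁, ⟨⟨x,1ⁿ⟩, 1^{P(2n+2+m)}⟩⟩ ∈ U`,
else `0` if `⟨e₂, ⟨⟨x,1ⁿ⟩, 1^{P(2n+2+m)}⟩⟩ ∈ U`, else `⊥`, is realised on the scheme encoding by a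
term of the `FP` algebra: the instances are `pairFn (const eᵢ) (pairFn ⟨fstP, fstP ∘ sndP⟩ pad)`
with the unary pad `padFn P` of the second component `⟨1ⁿ, 1ᵐ⟩` (of length `2n + 2 + m`), the two
membership bits are the indicator of `U` (`indicatorFn_mem_FP`), and the answer is selected by two
`iteFn`. [cite: BogdanovTrevisan2006, §2.2.1, Prop. 7 (proof: "A' … simulates A(x; n) for (p(n)/δ)^{1/ε} steps"; arXiv cs/0606037v2)] -/
theorem scheme_realiser {U : Language Bool} (hU : U ∈ Classes.P) (e₁ e₂ : List Bool)
    (P : Polynomial ℕ) :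
    PolyTimeComputable schemeEnc optBoolEnc fun q : List Bool × ℕ × ℕ =>
      if U.boolIndicator (boolPair e₁ (boolPair (paramEnc (q.1, q.2.1))
          (List.replicate (P.eval (2 * q.2.1 + 2 + q.2.2)) true))) then some true
      else if U.boolIndicator (boolPair e₂ (boolPair (paramEnc (q.1, q.2.1))
          (List.replicate (P.eval (2 * q.2.1 + 2 + q.2.2)) true))) then some false
      else none := by
  -- the pieces of the `FP` term
  let χ : List Bool → List Bool := fun w => encodeBool (U.boolIndicator w)
  let wFn : List Bool → List Bool := pairFn fstP (fstP ∘ sndP)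
  let uFn : List Bool → List Bool := OracleCompose.padFn P ∘ pairFn sndP (fun _ => [])
  let iFn : List Bool → List Bool → List Bool := fun e => pairFn (fun _ => e) (pairFn wFn uFn)
  let g : List Bool → List Bool :=
    iteFn (χ ∘ iFn e₁) (fun _ => [true, true]) (iteFn (χ ∘ iFn e₂) (fun _ => [true, false]) fun _ => [false])
  have hχ : χ ∈ FP := indicatorFn_mem_FP hU
  have hw : wFn ∈ FP := pairFn_mem_FP fstP_mem_FP (comp_mem_FP fstP_mem_FP sndP_mem_FP)
  have hu : uFn ∈ FP :=
    comp_mem_FP (OracleCompose.padFn_mem_FP P) (pairFn_mem_FP sndP_mem_FP (const_mem_FP _))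
  have hi : ∀ e, iFn e ∈ FP := fun e => pairFn_mem_FP (const_mem_FP _) (pairFn_mem_FP hw hu)
  have hg : g ∈ FP :=
    iteFn_mem_FP (comp_mem_FP hχ (hi e₁)) (const_mem_FP _)
      (iteFn_mem_FP (comp_mem_FP hχ (hi e₂)) (const_mem_FP _) (const_mem_FP _))
  refine PolyTimeComputable.of_encode hg schemeEnc (fun _ => rfl) fun q => ?_
  obtain ⟨x, n, m⟩ := q
  -- evaluation of the instances on the scheme encoding
  have hinst : ∀ e, iFn e (schemeEnc (x, n, m)) =
      boolPair e (boolPair (paramEnc (x, n)) (List.replicate (P.eval (2 * n + 2 + m)) true)) := by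
    intro e
    simp only [iFn, wFn, uFn, schemeEnc, paramEnc, pairFn_apply, Function.comp_apply,
      fstP_boolPair, sndP_boolPair, OracleCompose.padFn_apply, boolUnpair_boolPair,
      length_boolPair, length_unaryEncodeNat_eq']
  have hbit : ∀ e, (χ ∘ iFn e) (schemeEnc (x, n, m)) =
      [U.boolIndicator (boolPair e (boolPair (paramEnc (x, n))
        (List.replicate (P.eval (2 * n + 2 + m)) true)))] := by
    intro e
    rw [Function.comp_apply, hinst]
    rfl
  show g (schemeEnc (x, n, m)) = _
  simp only [g]
  rw [iteFn_apply (hbit e₁)]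
  split_ifs with h₁ h₂
  · rfl
  · rw [iteFn_apply (hbit e₂), if_pos h₂]
    rfl
  · rw [iteFn_apply (hbit e₂), if_neg h₂]
    rfl

/-! ### `AvgPLevin ⊆ AvgP` -/

/-- **Levin's average polynomial time yields an errorless heuristic scheme** (Bogdanov–Trevisan
2006, Prop. 7, first half of the proof, with the Markov step of Prop. 5; Impagliazzo 1995,
Prop. 2): if `(L, D)` is decided on the support of `Dₙ` by a machine `M` within `T(x, n)` steps
with `𝔼_{x∼Dₙ}[T(x,n)^ε] ≤ cn + c`, then `(L, D) ∈ AvgP`. The scheme queries the clocked universal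
acceptance language (`clockedUniversalAcceptance_holds`) for `M` and for `M` followed by negation
(`exists_neg_machine`), with budget `P(2n + 2 + m)` dominating both overhead polynomials at the
threshold `t = ((c+1)(n+1)m)^⌈1/ε⌉`; it is polynomial-time (`scheme_realiser`), errorless on the
support (soundness of the acceptance test and uniqueness of outputs, `TM2Std.outputs_unique`), and fails with probability
`≤ Pr[T(x,n) > t] ≤ (cn + c)/t^ε ≤ 1/m` (`Ensemble.prob_lt_le_of_moment_le`,
`natCast_le_pow_ceil_rpow`). No hypothesis on the lengths of the strings in the support is
needed in this direction. [cite: BogdanovTrevisan2006, §2.2.1, Prop. 7 (arXiv cs/0606037v2; with Prop. 5)] -/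
theorem mem_AvgP_of_mem_AvgPLevin {Q : DistProblem} (h : Q ∈ AvgPLevin) : Q ∈ AvgP := by
  obtain ⟨M, T, hM, ε, hε, c, hc⟩ := h
  -- a deterministic machine has at most one output word on a given input (the `OutputsWithin`
  -- form of `TM2Std.outputs_unique`, as in `AvM.outputsWithin_unique`)
  have huniq : ∀ {N : TM2ComputableAux Bool Bool} {l l₁ l₂ : List Bool} {m₁ m₂ : ℕ},
      N.OutputsWithin l l₁ m₁ → N.OutputsWithin l l₂ m₂ → l₁ = l₂ := fun {N} _ _ _ _ _ h₁ h₂ =>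
    List.map_injective_iff.2 N.outputAlphabet.symm.injective (TM2Std.outputs_unique N.tm h₁ h₂)
  obtain ⟨U, hU, hUniv⟩ := clockedUniversalAcceptance_holds
  obtain ⟨M', c₁, hM'⟩ := exists_neg_machine M
  obtain ⟨e₁, p₁, hcomp₁, hsound₁⟩ := hUniv M
  obtain ⟨e₂, p₂, hcomp₂, hsound₂⟩ := hUniv M'
  -- the threshold exponent and the budget polynomial
  set k : ℕ := ⌈1 / ε⌉₊ with hk
  let tp : Polynomial ℕ := (Polynomial.C (c + 1) * X ^ 2) ^ k
  let P : Polynomial ℕ := p₁.comp tp + p₂.comp (tp + Polynomial.C c₁)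
  have hP : ∀ y, P.eval y = p₁.eval (((c + 1) * y ^ 2) ^ k) + p₂.eval (((c + 1) * y ^ 2) ^ k + c₁) := by
    intro y
    simp [P, tp]
  -- the instances and the scheme
  let inst : List Bool → List Bool → ℕ → ℕ → List Bool := fun e x n m =>
    boolPair e (boolPair (paramEnc (x, n)) (List.replicate (P.eval (2 * n + 2 + m)) true))
  let A : List Bool → ℕ → ℕ → Option Bool := fun x n m =>
    if U.boolIndicator (inst e₁ x n m) then some true
    else if U.boolIndicator (inst e₂ x n m) then some false else none
  refine ⟨A, scheme_realiser hU e₁ e₂ P, fun m n x hx b hb => ?_, fun n m hm => ?_⟩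
  · -- errorless on the support
    have hMx := hM n x hx
    change (if U.boolIndicator (inst e₁ x n m) then some true
      else if U.boolIndicator (inst e₂ x n m) then some false else none) = some b at hb
    split_ifs at hb with h₁ h₂
    · -- `M` is certified to output `[true]`
      cases hb
      obtain ⟨t', ht'⟩ := hsound₁ _ _ ((Set.mem_iff_boolIndicator U _).2 h₁)
      have hu : [true] = [Q.lang.boolIndicator x] := huniq ht' hMx
      simp only [List.cons.injEq, and_true] at hu
      exact hu
    · -- `M'` is certified to output `[true]`, i.e. `M` outputs `[false]`
      cases hb
      obtain ⟨t', ht'⟩ := hsound₂ _ _ ((Set.mem_iff_boolIndicator U _).2 h₂)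
      have hneg := hM' _ _ _ hMx
      have hu : [true] = [!Q.lang.boolIndicator x] := huniq ht' hneg
      simp only [List.cons.injEq, and_true] at hu
      cases hq : Q.lang.boolIndicator x
      · rfl
      · rw [hq] at hu
        exact absurd hu (by decide)
  · -- failure probability: failing strings of the support have `T(x, n) > t`
    set b₀ : ℕ := (c + 1) * (n + 1) * m with hb₀
    set t : ℕ := b₀ ^ k with ht
    have hb₀1 : 1 ≤ b₀ := by
      rw [hb₀]
      exact Nat.mul_pos (Nat.mul_pos (Nat.succ_pos _) (Nat.succ_pos _)) hm
    have hty : t ≤ ((c + 1) * (2 * n + 2 + m) ^ 2) ^ k := by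
      rw [ht, hb₀]
      apply Nat.pow_le_pow_left
      have : (n + 1) * m ≤ (2 * n + 2 + m) ^ 2 := by nlinarith
      calc (c + 1) * (n + 1) * m = (c + 1) * ((n + 1) * m) := by ring
        _ ≤ (c + 1) * (2 * n + 2 + m) ^ 2 := Nat.mul_le_mul_left _ this
    have hsub : {x | A x n m = none} ∩ (Q.dist n).support ⊆ {x | t < T x n} := by
      rintro x ⟨hnone, hx⟩
      change (if U.boolIndicator (inst e₁ x n m) then some true
        else if U.boolIndicator (inst e₂ x n m) then some false else none) = none at hnone
      by_contra hlt
      have hle : T x n ≤ t := Nat.le_of_not_lt hlt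
      have hMx := hM n x hx
      cases hb : Q.lang.boolIndicator x
      · -- `M` outputs `[false]`: the second query is accepted
        rw [hb] at hMx
        have hneg := hM' _ _ _ hMx
        have hN : p₂.eval (c₁ + T x n) ≤ P.eval (2 * n + 2 + m) := by
          rw [hP]
          refine le_add_left (TM2Iter.eval_mono p₂ ?_)
          omega
        have hin : inst e₂ x n m ∈ U := hcomp₂ _ _ _ hneg hN
        have hin' : U.boolIndicator (inst e₂ x n m) = true := (Set.mem_iff_boolIndicator U _).1 hin
        split_ifs at hnone
      · -- `M` outputs `[true]`: the first query is accepted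
        rw [hb] at hMx
        have hN : p₁.eval (T x n) ≤ P.eval (2 * n + 2 + m) := by
          rw [hP]
          exact le_add_right (TM2Iter.eval_mono p₁ (hle.trans hty))
        have hin : inst e₁ x n m ∈ U := hcomp₁ _ _ _ hMx hN
        have hin' : U.boolIndicator (inst e₁ x n m) = true := (Set.mem_iff_boolIndicator U _).1 hin
        split_ifs at hnone
    refine (Q.dist.prob_mono n hsub).trans ?_
    -- Markov
    have hB : ∑' x, Q.dist n x * ENNReal.ofReal ((T x n : ℝ) ^ ε) ≤
        ENNReal.ofReal ((c * n + c : ℕ) : ℝ) := by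
      rw [ENNReal.ofReal_natCast]
      exact hc n
    have hK : (0 : ℝ) < b₀ := by exact_mod_cast hb₀1
    have hmarkov := Q.dist.prob_lt_le_of_moment_le (t := t) hε (Nat.cast_nonneg _) hB hK
      (by rw [ht, hk]; exact natCast_le_pow_ceil_rpow hε hb₀1)
    refine hmarkov.trans ?_
    have hm' : (0 : ℝ) < m := by exact_mod_cast hm
    rw [div_le_div_iff₀ hK hm', one_mul, hb₀]
    have hcn : ((c * n + c : ℕ) : ℝ) ≤ ((c + 1) * (n + 1) : ℕ) := by
      exact_mod_cast (by nlinarith : c * n + c ≤ (c + 1) * (n + 1))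
    calc ((c * n + c : ℕ) : ℝ) * m ≤ ((c + 1) * (n + 1) : ℕ) * m := by gcongr
      _ = (((c + 1) * (n + 1) * m : ℕ) : ℝ) := by push_cast; ring

end Literature.Computability.MetaComplexity
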